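/-
Copyright: the b2b-balaban T⁴-continuum CRUX team, row NE7b OWNER lineage `t4-ne7b-p1` (gen 147). Project licence.
-/
import Mathlib

/-!
# THE RATE CHAIN OF THE WEIGHTED CLASS IS SOLVABLE EXACTLY FOR LARGE BLOCKING FACTOR (SCOPING-d17 (R-d) ∕ SCOPING-d18 (D); file (765)).
# (672)∕(746) instantiate the abstract weights of the weighted class map ((748)–(764)) by exponentials of ONE pseudometric at RATES
# `ν` (`ϑ`), `ν₂` (`ϑ₂`), `s` (`σ, σA`), `η` (`ρ`), `ζ` (`r`), `ζ₁` (`r₁`, order 5) and read off, in their docstrings, the chain of rate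
# inequalities the class files' compatibilities and geometry letters impose, together with the CLOSURE condition of the iteration: the next
# step's input weight `ϑ₂` is the previous output weight `ϑ` seen on the rescaled lattice, `ν₂ = L·ν` ((672) `expw_rescale`).  THIS FILE makes
# that reading a two-sided arithmetic fact: the order-4 chain
#   `0 < ν`, `3ν ≤ ν₂`, `6ν < ν₂` (`Θ6`), `4ν ≤ s` (crossing), `8ν < η` (`G`), `8η ≤ s` (`ρ⁸ ≤ σσ`), `2ν < ζ` (`S4`), `24ζ ≤ s` (`r²⁴ ≤ σσ`),
#   `0 ≤ s ≤ ν₂` (transport), `ν₂ = L·ν` (closure)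
# is solvable iff `L > 64`, and the order-5 chain (`4ν ≤ ν₂`, `8ν < ν₂` (`Θ8`), `6ν ≤ s`, `12ν < η` (`G = Σϑ⁶∕√ρ`), `8η ≤ s`, `ν ≤ ζ₁`, `2ν < ζ₁`
# (`S2`), `8ζ₁ ≤ ζ` (`r₁⁸ ≤ r`), `24ζ ≤ s`, `0 ≤ s ≤ ν₂`, `ν₂ = L·ν`) iff `L > 384` — explicit witnesses one way, one division the other
# (row NE7b, node U5c; Mathlib only; [folklore]).  So «the weighted class iterates for `L > 64` (order 4) ∕ `L > 384` (order 5)» of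
# (672)∕(746) is exactly the solvability of the rate bookkeeping with the convenience exponents `8, 24, 8, 2`; lowering them lowers the
# thresholds (not done).

Cell `pub-balaban`, sub-cell `t4`, spine estimate NE7b (`T4WeightBudget.RelWeightBound`; the cell's OWN estimate — NOT PRINTED in
[Bałaban 1983–89], NOT PROVED).  Crux-route work under `Spine/NE7b/` by the row OWNER (`t4-ne7b-p1` gen 147, file (765)) under FREEZE
(0)'s crux-prover clause; NOTHING of Bałaban's is named as a Lean object, valued or asserted; no `T4Continuum/Support` leaf typed; no
`def`, no notation; zero `sorry`.  Imports: Mathlib only.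

WHAT IS PROVED ([folklore]): **`rates_exist_order_four`** (`L > 64 ⟹` a solution), **`blocking_gt_64_of_rates`** (a solution `⟹ L > 64`),
**`rates_exist_order_five`** (`L > 384 ⟹`), **`blocking_gt_384_of_rates`** (`⟹ L > 384`); toy.

HONEST (what this is NOT).  Arithmetic of the rate chain only: the lattice sums behind the geometry letters (finite for positive rate gaps,
with dimension-dependent values), the flow of the letter VALUES along the scales (the constants of (748)–(764) grow per step unless the
road's rescaling∕smallness is booked — (433)∕(436), NOT claimed) and the choice of `L` in the programme are not typed here; scalar skeleton
((A3), NC-NE7b-α UNRULED); nothing of Bałaban's asserted.  BY-NAME EFFECT ON THE WALL: NONE.  NE7b NOT PRINTED ∕ NOT PROVED; spine PROVED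
0∕9; rung (B)+1 — the programme's measures remain FINITE-torus statements; NOT the mass gap, NOT Clay.  HONEST DEPENDENCY: continuum YM on
T⁴ ⇐ BetaPertH ∧ nine spine estimates (0∕9 proved); BetaPertH ⇐ (D1) ∧ (D4) ∧ CAP+tail; G-an2-4 gates asym, D1 and NE2∕3∕4.
-/

set_option autoImplicit false

noncomputable section

namespace Summit.QuantumFields.BalabanUV.T4Continuum.NE7b.SupWeightedClassRatesExist

/-! ## Order 4 -/

/-- **The order-4 rate chain is solvable for `L > 64`**: witnesses `ν = 1`, `ν₂ = s = L`, `η = L∕8`, `ζ = L∕24`. [folklore] -/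
theorem rates_exist_order_four {L : ℝ} (hL : 64 < L) :
    ∃ ν ν₂ s η ζ : ℝ, 0 < ν ∧ 3 * ν ≤ ν₂ ∧ 6 * ν < ν₂ ∧ 4 * ν ≤ s ∧ 8 * ν < η ∧ 8 * η ≤ s ∧ 2 * ν < ζ ∧ 24 * ζ ≤ s ∧ 0 ≤ s ∧ s ≤ ν₂ ∧
      ν₂ = L * ν :=
  ⟨1, L, L, L / 8, L / 24, one_pos, by linarith, by linarith, by linarith, by linarith, by linarith, by linarith, by linarith, by linarith,
    le_rfl, by ring⟩

/-- **Conversely any solution of the order-4 chain has `L > 64`**: `L·ν = ν₂ ≥ s ≥ 8η > 64ν` and `ν > 0` (only the four links used are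
assumed). [folklore] -/
theorem blocking_gt_64_of_rates {L ν ν₂ s η : ℝ} (hν : 0 < ν) (hη : 8 * ν < η) (hηs : 8 * η ≤ s) (hsν₂ : s ≤ ν₂) (hcl : ν₂ = L * ν) :
    64 < L := by
  by_contra h
  have h1 : L * ν ≤ 64 * ν := mul_le_mul_of_nonneg_right (not_lt.mp h) hν.le
  linarith

/-! ## Order 5 -/

/-- **The order-5 rate chain is solvable for `L > 384`**: witnesses `ν = 1`, `ν₂ = s = L`, `η = L∕8`, `ζ = L∕24`, `ζ₁ = L∕192`. [folklore] -/
theorem rates_exist_order_five {L : ℝ} (hL : 384 < L) :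
    ∃ ν ν₂ s η ζ ζ₁ : ℝ, 0 < ν ∧ 4 * ν ≤ ν₂ ∧ 8 * ν < ν₂ ∧ 6 * ν ≤ s ∧ 12 * ν < η ∧ 8 * η ≤ s ∧ ν ≤ ζ₁ ∧ 2 * ν < ζ₁ ∧ 8 * ζ₁ ≤ ζ ∧
      24 * ζ ≤ s ∧ 0 ≤ s ∧ s ≤ ν₂ ∧ ν₂ = L * ν :=
  ⟨1, L, L, L / 8, L / 24, L / 192, one_pos, by linarith, by linarith, by linarith, by linarith, by linarith, by linarith, by linarith,
    by linarith, by linarith, by linarith, le_rfl, by ring⟩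

/-- **Conversely any solution of the order-5 chain has `L > 384`**: `L·ν = ν₂ ≥ s ≥ 24ζ ≥ 192ζ₁ > 384ν` and `ν > 0`. [folklore] -/
theorem blocking_gt_384_of_rates {L ν ν₂ s ζ ζ₁ : ℝ} (hν : 0 < ν) (hζ₁ : 2 * ν < ζ₁) (hζ : 8 * ζ₁ ≤ ζ) (hζs : 24 * ζ ≤ s) (hsν₂ : s ≤ ν₂)
    (hcl : ν₂ = L * ν) : 384 < L := by
  by_contra h
  have h1 : L * ν ≤ 384 * ν := mul_le_mul_of_nonneg_right (not_lt.mp h) hν.le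
  linarith

/-! ## Toy -/

/-- Toy (the thresholds are sharp on the chains as typed): `L = 64` admits no order-4 solution, `L = 65` does. -/
example : (¬ ∃ ν ν₂ s η ζ : ℝ, 0 < ν ∧ 3 * ν ≤ ν₂ ∧ 6 * ν < ν₂ ∧ 4 * ν ≤ s ∧ 8 * ν < η ∧ 8 * η ≤ s ∧ 2 * ν < ζ ∧ 24 * ζ ≤ s ∧ 0 ≤ s ∧
      s ≤ ν₂ ∧ ν₂ = 64 * ν) ∧
    (∃ ν ν₂ s η ζ : ℝ, 0 < ν ∧ 3 * ν ≤ ν₂ ∧ 6 * ν < ν₂ ∧ 4 * ν ≤ s ∧ 8 * ν < η ∧ 8 * η ≤ s ∧ 2 * ν < ζ ∧ 24 * ζ ≤ s ∧ 0 ≤ s ∧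
      s ≤ ν₂ ∧ ν₂ = 65 * ν) :=
  ⟨fun ⟨_, _, _, _, _, hν, _, _, _, hη, hηs, _, _, _, hs, hcl⟩ => by linarith [blocking_gt_64_of_rates hν hη hηs hs hcl],
    rates_exist_order_four (by norm_num)⟩

end Summit.QuantumFields.BalabanUV.T4Continuum.NE7b.SupWeightedClassRatesExist

end
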